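import Mathlib

/-!
# Configurations with prescribed fibre states are counted by a product

For an edge type that is a sigma type `Σ i, κ i` (the edges of the `i`-th branch are `κ i`), a
configuration `ω : (Σ i, κ i) → Bool` restricts to a **fibre state** `fun j => ω ⟨i, j⟩` on every
branch `i`.  If every fibre state is required to lie in a prescribed finite set `A i`, the number of
configurations is `∏ i, #(A i)` (`card_filter_fibres_eq_prod`).  When the index type is a sum of
`Fin`s and the prescribed sets depend only on the summand, the product is a product of powers
(`prod_sum_elim_const_four`).  Both are generic counting lemmas (Mathlib only).
-/

namespace PercRepro

open Finset

/-- The fibre state of a configuration on a sigma edge type at the index `i`. -/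
def fibreState {ι : Type*} {κ : ι → Type*} (ω : (Σ i, κ i) → Bool) (i : ι) : κ i → Bool :=
  fun j => ω ⟨i, j⟩

/-- **Product count.** Configurations on `Σ i, κ i` whose every fibre state lies in `A i` are counted
by `∏ i, #(A i)`. -/
theorem card_filter_fibres_eq_prod {ι : Type*} [Fintype ι] [DecidableEq ι] {κ : ι → Type*}
    [∀ i, Fintype (κ i)] [∀ i, DecidableEq (κ i)] (A : ∀ i, Finset (κ i → Bool)) :
    (univ.filter fun ω : (Σ i, κ i) → Bool => ∀ i, fibreState ω i ∈ A i).card =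
      ∏ i, (A i).card := by
  have h : (univ.filter fun ω : (Σ i, κ i) → Bool => ∀ i, fibreState ω i ∈ A i) =
      (Fintype.piFinset A).map (Equiv.piCurry fun (_ : ι) (_ : κ _) => Bool).symm.toEmbedding := by
    ext ω
    simp only [mem_filter, mem_univ, true_and, mem_map_equiv, Equiv.symm_symm,
      Fintype.mem_piFinset]
    exact Iff.rfl
  rw [h, card_map, Fintype.card_piFinset]

/-- A product over `Fin p ⊕ Fin q ⊕ Fin r ⊕ Fin s` of a function constant on each summand is a
product of four powers. -/
theorem prod_sum_elim_const_four {M : Type*} [CommMonoid M] (p q r s : ℕ) (x y z w : M) :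
    (∏ i : Fin p ⊕ Fin q ⊕ Fin r ⊕ Fin s,
      Sum.elim (fun _ => x) (Sum.elim (fun _ => y) (Sum.elim (fun _ => z) (fun _ => w))) i) =
      x ^ p * y ^ q * z ^ r * w ^ s := by
  rw [Fintype.prod_sum_type, Fintype.prod_sum_type, Fintype.prod_sum_type]
  simp only [Sum.elim_inl, Sum.elim_inr, prod_const, card_univ, Fintype.card_fin, mul_assoc]

end PercRepro
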